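import Summits.Ventures.LatticeQCDFlow.Exactness.IMHCouplingTotalVariationDiagnostic
import Summits.Ventures.LatticeQCDFlow.Exactness.IMHCoupledEstimatorHoeffding
import HarnessLib

/-!
# The empirical total-variation certificate: with probability `≥ 1 − m·exp(−2Rε²)`, for EVERY measurable set `S` (every bounded observable),
# `|π(S) − P(Y_b ∈ S)| ≤ (observed residual disagreements of R coupled pairs on the window [b, b+m)) / R + mε + r^{b+m} p₀ W`

HONEST FRAMING: exact (Metropolis-corrected) sampling algorithms for lattice gauge theory;
figures of merit are autocorrelation/cost numbers at stated couplings and volumes; no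
continuum-physics claim.

Venture `LatticeQCDFlow` (cell pub-lqcd), topic `Exactness`; FANOUT row 30 (lean-1, GEN-39).  NEW WORK of the cell (`MeasurableEq Ω`); sequel to
`Exactness/IMHCouplingTotalVariationDiagnostic` (`|π(S) − P(Y_b ∈ S)| ≤ Σ_{n≥0} P(X_{b+n} ≠ X′_{b+n})` under the lag-one coupling, the sum
`≤ r^b p₀ W`) and `Exactness/IMHCoupledEstimatorHoeffding` (Hoeffding for averages of bounded independent variables).  The right side of the
diagnostic is ESTIMATED from `R` mutually independent coupled pairs `Z_0, …, Z_{R−1}` with the law of the pair chain (the unmerged indicator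
`1{Z_j(t) ∉ Δ}` has mean `P(X_t ≠ X′_t)`), which turns the diagnostic into a finite-sample certificate (`W = w(x₀)`, `r = 1 − 1/W`, `p₀ = ν̂(Δᶜ)`):

* §1 **`replicas_unmerged_integral_eq`** — `E 1{Z_j(t) ∉ Δ} = P(X_t ≠ X′_t)`; **`replicas_unmerged_hoeffding_le`** — the unmerged FRACTION
  `U_t = R⁻¹ #{j < R : Z_j(t) ∉ Δ}` undershoots by `ε` with probability `≤ exp(−2Rε²)`; **`replicas_unmerged_window_hoeffding_le`** — on a window of
  `m` times simultaneously except with probability `≤ m·exp(−2Rε²)`.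
* §2 **`crnLag_replicas_tsum_offDiagonal_certificate`** — with probability `≥ 1 − m·exp(−2Rε²)`:
  `Σ_{n≥0} P(X_{b+n} ≠ X′_{b+n}) ≤ R⁻¹ Σ_{j<R} Σ_{n<m} 1{Z_j(b + n) ∉ Δ} + mε + r^{b+m} p₀ W` (window + Hoeffding slack + geometric tail).
* §3 **`crnLag_replicas_totalVariation_certificate`** — THE CERTIFICATE: with probability `≥ 1 − m·exp(−2Rε²)`, SIMULTANEOUSLY FOR EVERY measurable
  `S`, `|π(S) − P(Y_b ∈ S)| ≤ R⁻¹ Σ_{j<R} Σ_{n<m} 1{Z_j(b + n) ∉ Δ} + mε + r^{b+m} p₀ W`; **`crnLag_replicas_bias_certificate`** — the same event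
  certifies `|π f − E f(Y_b)| ≤ (c − a)·(…)` for EVERY measurable `a ≤ f ≤ c` at once.
Reading (gauge files): run `R` coupled pairs of the exact gauge sampler one update apart; count, per pair, the updates in `[b, b + m)` on which the
two configurations differ; the average count plus `mε` plus the certified geometric remainder bounds — with confidence `1 − m·exp(−2Rε²)` — the
systematic error at time `b` of every bounded measurement in units of its range, with no reference value and no knowledge of `A`.
NOT CLAIMED: a variance-sensitive slack; dependence between the certificate's pairs and the production run (they are separate replicas with the
same law); lag `L > 1`; optimal choice of `m`, `ε`; any value of `A`.  No `sorry`, no new definitions, nothing cited as a fact.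
-/

noncomputable section

namespace Summit.Ventures.LatticeQCDFlow.Exactness

open MeasureTheory ProbabilityTheory Function Finset Filter
open scoped ENNReal unitInterval Topology
open Summit.Ventures.LatticeQCDFlow.Scoring

variable {Ω : Type*} [MeasurableSpace Ω] {q : Measure Ω} [IsProbabilityMeasure q] {w : Ω → ℝ}
variable {Ω' : Type*} {mΩ' : MeasurableSpace Ω'} {μ : Measure Ω'} [IsProbabilityMeasure μ] {Z : ℕ → Ω' → (ℕ → Ω × Ω)}

/-! ## §1 The unmerged fraction across independent coupled pairs -/

omit [IsProbabilityMeasure μ] in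
/-- **`E 1{Z_j(t) ∉ Δ} = P(X_t ≠ X′_t)`** for a replica with the law of the pair chain from `ν̂` (`MeasurableEq Ω`). [ours, transfer] -/
theorem replicas_unmerged_integral_eq [MeasurableEq Ω] (Khat : Kernel (Ω × Ω) (Ω × Ω)) [IsMarkovKernel Khat]
    (ν : Measure (Ω × Ω)) [IsProbabilityMeasure ν] (hZm : ∀ j, Measurable (Z j))
    (hlaw : ∀ j, μ.map (Z j) = Kernel.trajMeasure (X := fun _ : ℕ => Ω × Ω) ν
      (fun n : ℕ => Khat.comap (fun h : (i : ↥(Finset.Iic n)) → Ω × Ω => h ⟨n, Finset.mem_Iic.2 le_rfl⟩)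
        (measurable_pi_apply _))) (j t : ℕ) :
    μ[fun ω => (Set.diagonal Ω)ᶜ.indicator (1 : Ω × Ω → ℝ) (Z j ω t)] =
      ((fun m : Measure (Ω × Ω) => m.bind Khat)^[t] ν).real (Set.diagonal Ω)ᶜ := by
  have hD : MeasurableSet (Set.diagonal Ω) := measurableSet_diagonal
  have hIm : Measurable ((Set.diagonal Ω)ᶜ.indicator (1 : Ω × Ω → ℝ)) := measurable_one.indicator hD.compl
  have h := integral_comp_eq_of_map_eq (hZm j) (hlaw j) (hIm.comp (measurable_pi_apply t))
  dsimp only [Function.comp] at h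
  rw [h, chain_expect_eq_integral_iterate_bind Khat ν hIm (fun p => abs_indicator_offDiagonal_le_one p) t,
    integral_indicator_one hD.compl]

/-- **HOEFFDING FOR THE UNMERGED FRACTION (lower deviation)**: mutually independent replicas, `ε ≥ 0`, `R ≥ 1`:
`P(P(X_t ≠ X′_t) − R⁻¹ Σ_{j<R} 1{Z_j(t) ∉ Δ} ≥ ε) ≤ exp(−2Rε²)`. [ours — the Hoeffding lemma of `…CoupledEstimatorHoeffding` applied] -/
theorem replicas_unmerged_hoeffding_le [MeasurableEq Ω] (Khat : Kernel (Ω × Ω) (Ω × Ω)) [IsMarkovKernel Khat]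
    (ν : Measure (Ω × Ω)) [IsProbabilityMeasure ν] (hZm : ∀ j, Measurable (Z j))
    (hlaw : ∀ j, μ.map (Z j) = Kernel.trajMeasure (X := fun _ : ℕ => Ω × Ω) ν
      (fun n : ℕ => Khat.comap (fun h : (i : ↥(Finset.Iic n)) → Ω × Ω => h ⟨n, Finset.mem_Iic.2 le_rfl⟩)
        (measurable_pi_apply _)))
    (hind : iIndepFun Z μ) {ε : ℝ} (hε : 0 ≤ ε) {R : ℕ} (hR : 1 ≤ R) (t : ℕ) :
    μ.real {ω | ε ≤ ((fun m : Measure (Ω × Ω) => m.bind Khat)^[t] ν).real (Set.diagonal Ω)ᶜ -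
        (R : ℝ)⁻¹ * ∑ j ∈ range R, (Set.diagonal Ω)ᶜ.indicator (1 : Ω × Ω → ℝ) (Z j ω t)} ≤ Real.exp (-(2 * R * ε ^ 2)) := by
  have hIm : Measurable ((Set.diagonal Ω)ᶜ.indicator (1 : Ω × Ω → ℝ)) := measurable_one.indicator measurableSet_diagonal.compl
  have hgm : Measurable (fun z : ℕ → Ω × Ω => (Set.diagonal Ω)ᶜ.indicator (1 : Ω × Ω → ℝ) (z t)) := hIm.comp (measurable_pi_apply t)
  have h := hoeffding_avg_le_of_mem_Icc (μ := μ) (X := fun j ω => (Set.diagonal Ω)ᶜ.indicator (1 : Ω × Ω → ℝ) (Z j ω t))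
    (fun j => hgm.comp (hZm j)) (hind.comp (fun _ => _) fun _ => hgm) (a := 0) (b := 1)
    (fun j ω => ⟨Set.indicator_nonneg (fun _ _ => zero_le_one) _, (le_abs_self _).trans (abs_indicator_offDiagonal_le_one _)⟩)
    (fun j => replicas_unmerged_integral_eq Khat ν hZm hlaw j t) hε hR
  rwa [sub_zero, one_pow, div_one] at h

/-- **… ON A WINDOW OF `m` TIMES SIMULTANEOUSLY**: `P(∃ n < m, P(X_{b+n} ≠ X′_{b+n}) − U_{b+n} ≥ ε) ≤ m·exp(−2Rε²)`. [ours] -/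
theorem replicas_unmerged_window_hoeffding_le [MeasurableEq Ω] (Khat : Kernel (Ω × Ω) (Ω × Ω)) [IsMarkovKernel Khat]
    (ν : Measure (Ω × Ω)) [IsProbabilityMeasure ν] (hZm : ∀ j, Measurable (Z j))
    (hlaw : ∀ j, μ.map (Z j) = Kernel.trajMeasure (X := fun _ : ℕ => Ω × Ω) ν
      (fun n : ℕ => Khat.comap (fun h : (i : ↥(Finset.Iic n)) → Ω × Ω => h ⟨n, Finset.mem_Iic.2 le_rfl⟩)
        (measurable_pi_apply _)))
    (hind : iIndepFun Z μ) {ε : ℝ} (hε : 0 ≤ ε) {R : ℕ} (hR : 1 ≤ R) (b m : ℕ) :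
    μ.real (⋃ n ∈ range m, {ω | ε ≤ ((fun m : Measure (Ω × Ω) => m.bind Khat)^[b + n] ν).real (Set.diagonal Ω)ᶜ -
        (R : ℝ)⁻¹ * ∑ j ∈ range R, (Set.diagonal Ω)ᶜ.indicator (1 : Ω × Ω → ℝ) (Z j ω (b + n))}) ≤ m * Real.exp (-(2 * R * ε ^ 2)) := by
  calc μ.real (⋃ n ∈ range m, {ω | ε ≤ ((fun m : Measure (Ω × Ω) => m.bind Khat)^[b + n] ν).real (Set.diagonal Ω)ᶜ -
        (R : ℝ)⁻¹ * ∑ j ∈ range R, (Set.diagonal Ω)ᶜ.indicator (1 : Ω × Ω → ℝ) (Z j ω (b + n))})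
      ≤ ∑ n ∈ range m, μ.real {ω | ε ≤ ((fun m : Measure (Ω × Ω) => m.bind Khat)^[b + n] ν).real (Set.diagonal Ω)ᶜ -
        (R : ℝ)⁻¹ * ∑ j ∈ range R, (Set.diagonal Ω)ᶜ.indicator (1 : Ω × Ω → ℝ) (Z j ω (b + n))} := measureReal_biUnion_finset_le _ _
    _ ≤ ∑ n ∈ range m, Real.exp (-(2 * R * ε ^ 2)) :=
        sum_le_sum fun n _ => replicas_unmerged_hoeffding_le Khat ν hZm hlaw hind hε hR (b + n)
    _ = m * Real.exp (-(2 * R * ε ^ 2)) := by rw [sum_const, card_range, nsmul_eq_mul]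

/-! ## §2 The series of disagreement probabilities, certified from the observed window -/

omit [MeasurableSpace Ω] in
/-- `Σ_{n<m} p_n ≤ Σ_{n<m} u_n + mε` when `p_n − u_n < ε` for every `n < m`. [ours, bookkeeping] -/
theorem sum_le_sum_add_of_forall_sub_lt {p u : ℕ → ℝ} {ε : ℝ} {m : ℕ} (h : ∀ n < m, p n - u n < ε) :
    ∑ n ∈ range m, p n ≤ ∑ n ∈ range m, u n + m * ε := by
  calc ∑ n ∈ range m, p n ≤ ∑ n ∈ range m, (u n + ε) := sum_le_sum fun n hn => by linarith [h n (mem_range.1 hn)]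
    _ = ∑ n ∈ range m, u n + m * ε := by rw [sum_add_distrib, sum_const, card_range, nsmul_eq_mul]

/-- **WINDOW + TAIL**: `Σ_{n≥0} P(X_{b+n} ≠ X′_{b+n}) ≤ Σ_{n<m} P(X_{b+n} ≠ X′_{b+n}) + r^{b+m} p₀ W` (every initial coupling). [ours] -/
theorem crn_chain_tsum_offDiagonal_shift_le_window [MeasurableEq Ω] (hw : Measurable w) (hw0 : ∀ y, 0 < w y) {x₀ : Ω}
    (hmax : ∀ y, w y ≤ w x₀) [IsProbabilityMeasure (q.withDensity fun y => ENNReal.ofReal (w y))]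
    (Khat : Kernel (Ω × Ω) (Ω × Ω)) [IsMarkovKernel Khat]
    (hK : ∀ z : Ω × Ω, Khat z = (q.prod (volume : Measure unitInterval)).map (fun p : Ω × unitInterval =>
      ((if (p.2 : ℝ) * w z.1 ≤ w p.1 then p.1 else z.1), (if (p.2 : ℝ) * w z.2 ≤ w p.1 then p.1 else z.2))))
    (ν : Measure (Ω × Ω)) [IsProbabilityMeasure ν] (b m : ℕ) :
    ∑' n, ((fun m : Measure (Ω × Ω) => m.bind Khat)^[b + n] ν).real (Set.diagonal Ω)ᶜ ≤
      ∑ n ∈ range m, ((fun m : Measure (Ω × Ω) => m.bind Khat)^[b + n] ν).real (Set.diagonal Ω)ᶜ +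
        (1 - (w x₀)⁻¹) ^ (b + m) * ν.real (Set.diagonal Ω)ᶜ * w x₀ := by
  obtain ⟨hsum, -⟩ := crn_chain_summable_offDiagonal_shift hw hw0 hmax Khat hK ν b
  obtain ⟨-, htail⟩ := crn_chain_summable_offDiagonal_shift hw hw0 hmax Khat hK ν (b + m)
  have hidx : (fun n => ((fun m : Measure (Ω × Ω) => m.bind Khat)^[b + (n + m)] ν).real (Set.diagonal Ω)ᶜ) =
      fun n => ((fun m : Measure (Ω × Ω) => m.bind Khat)^[b + m + n] ν).real (Set.diagonal Ω)ᶜ := by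
    funext n; rw [show b + (n + m) = b + m + n by omega]
  rw [← hsum.sum_add_tsum_nat_add m, hidx]
  linarith [htail]

/-- **THE SERIES, CERTIFIED FROM DATA**: lag-free statement (every initial coupling `ν̂`); mutually independent replicas with the law of the pair
chain; `ε ≥ 0`, `R ≥ 1`, window `[b, b + m)`.  With probability `≥ 1 − m·exp(−2Rε²)`:
`Σ_{n≥0} P(X_{b+n} ≠ X′_{b+n}) ≤ R⁻¹ Σ_{j<R} Σ_{n<m} 1{Z_j(b + n) ∉ Δ} + mε + r^{b+m} p₀ W`. [ours] -/
theorem crnLag_replicas_tsum_offDiagonal_certificate [MeasurableEq Ω] (hw : Measurable w) (hw0 : ∀ y, 0 < w y) {x₀ : Ω}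
    (hmax : ∀ y, w y ≤ w x₀) [IsProbabilityMeasure (q.withDensity fun y => ENNReal.ofReal (w y))]
    (Khat : Kernel (Ω × Ω) (Ω × Ω)) [IsMarkovKernel Khat]
    (hK : ∀ z : Ω × Ω, Khat z = (q.prod (volume : Measure unitInterval)).map (fun p : Ω × unitInterval =>
      ((if (p.2 : ℝ) * w z.1 ≤ w p.1 then p.1 else z.1), (if (p.2 : ℝ) * w z.2 ≤ w p.1 then p.1 else z.2))))
    (ν : Measure (Ω × Ω)) [IsProbabilityMeasure ν] (hZm : ∀ j, Measurable (Z j))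
    (hlaw : ∀ j, μ.map (Z j) = Kernel.trajMeasure (X := fun _ : ℕ => Ω × Ω) ν
      (fun n : ℕ => Khat.comap (fun h : (i : ↥(Finset.Iic n)) → Ω × Ω => h ⟨n, Finset.mem_Iic.2 le_rfl⟩)
        (measurable_pi_apply _)))
    (hind : iIndepFun Z μ) {ε : ℝ} (hε : 0 ≤ ε) {R : ℕ} (hR : 1 ≤ R) (b m : ℕ) :
    1 - m * Real.exp (-(2 * R * ε ^ 2)) ≤ μ.real {ω |
      ∑' n, ((fun m : Measure (Ω × Ω) => m.bind Khat)^[b + n] ν).real (Set.diagonal Ω)ᶜ ≤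
        (R : ℝ)⁻¹ * ∑ j ∈ range R, ∑ n ∈ range m, (Set.diagonal Ω)ᶜ.indicator (1 : Ω × Ω → ℝ) (Z j ω (b + n)) + m * ε +
          (1 - (w x₀)⁻¹) ^ (b + m) * ν.real (Set.diagonal Ω)ᶜ * w x₀} := by
  set B : Set Ω' := ⋃ n ∈ range m, {ω | ε ≤ ((fun m : Measure (Ω × Ω) => m.bind Khat)^[b + n] ν).real (Set.diagonal Ω)ᶜ -
        (R : ℝ)⁻¹ * ∑ j ∈ range R, (Set.diagonal Ω)ᶜ.indicator (1 : Ω × Ω → ℝ) (Z j ω (b + n))} with hB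
  have hIm : Measurable ((Set.diagonal Ω)ᶜ.indicator (1 : Ω × Ω → ℝ)) := measurable_one.indicator measurableSet_diagonal.compl
  have hUm : ∀ t, Measurable fun ω => (R : ℝ)⁻¹ * ∑ j ∈ range R, (Set.diagonal Ω)ᶜ.indicator (1 : Ω × Ω → ℝ) (Z j ω t) := fun t =>
    (Finset.measurable_sum _ fun j _ => hIm.comp ((measurable_pi_apply t).comp (hZm j))).const_mul _
  have hBm : MeasurableSet B := by
    refine MeasurableSet.biUnion (countable_toSet _) fun n _ => ?_
    exact measurableSet_le measurable_const (measurable_const.sub (hUm (b + n)))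
  have hBle : μ.real B ≤ m * Real.exp (-(2 * R * ε ^ 2)) := replicas_unmerged_window_hoeffding_le Khat ν hZm hlaw hind hε hR b m
  have hcompl : μ.real Bᶜ = 1 - μ.real B := by rw [measureReal_compl hBm, probReal_univ]
  have hsub : Bᶜ ⊆ {ω | ∑' n, ((fun m : Measure (Ω × Ω) => m.bind Khat)^[b + n] ν).real (Set.diagonal Ω)ᶜ ≤
      (R : ℝ)⁻¹ * ∑ j ∈ range R, ∑ n ∈ range m, (Set.diagonal Ω)ᶜ.indicator (1 : Ω × Ω → ℝ) (Z j ω (b + n)) + m * ε +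
        (1 - (w x₀)⁻¹) ^ (b + m) * ν.real (Set.diagonal Ω)ᶜ * w x₀} := by
    intro ω hω
    simp only [hB, Set.mem_compl_iff, Set.mem_iUnion, Set.mem_setOf_eq, not_exists, exists_prop, not_and, not_le] at hω
    have hwin := sum_le_sum_add_of_forall_sub_lt (m := m) (ε := ε)
      (p := fun n => ((fun m : Measure (Ω × Ω) => m.bind Khat)^[b + n] ν).real (Set.diagonal Ω)ᶜ)
      (u := fun n => (R : ℝ)⁻¹ * ∑ j ∈ range R, (Set.diagonal Ω)ᶜ.indicator (1 : Ω × Ω → ℝ) (Z j ω (b + n)))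
      (fun n hn => hω n (mem_range.2 hn))
    have hswap : ∑ n ∈ range m, (R : ℝ)⁻¹ * ∑ j ∈ range R, (Set.diagonal Ω)ᶜ.indicator (1 : Ω × Ω → ℝ) (Z j ω (b + n)) =
        (R : ℝ)⁻¹ * ∑ j ∈ range R, ∑ n ∈ range m, (Set.diagonal Ω)ᶜ.indicator (1 : Ω × Ω → ℝ) (Z j ω (b + n)) := by
      rw [← mul_sum, sum_comm]
    have htail := crn_chain_tsum_offDiagonal_shift_le_window hw hw0 hmax Khat hK ν b m
    simp only [Set.mem_setOf_eq]
    linarith [hwin, hswap.le, hswap.ge, htail]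
  calc 1 - m * Real.exp (-(2 * R * ε ^ 2)) ≤ 1 - μ.real B := by linarith [hBle]
    _ = μ.real Bᶜ := hcompl.symm
    _ ≤ _ := measureReal_mono hsub

/-! ## §3 The certificate, uniformly over observables -/

/-- **THE EMPIRICAL TOTAL-VARIATION CERTIFICATE.**  `w` a `Fact`-measurable normalised weight, positive, maximal at `x₀` (`W = w(x₀)`,
`r = 1 − 1/W`); `K̂` a CRN pair kernel; the initial coupling `ν̂` one update ahead (`ν̂∘fst⁻¹ = (ν̂∘snd⁻¹)K`, so the second coordinate at time `b`
is the production run `Y_b`); `Z_0, …, Z_{R−1}` mutually independent with the law of the pair chain; `ε ≥ 0`, `R ≥ 1`, window `[b, b + m)`.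
Then with probability `≥ 1 − m·exp(−2Rε²)`, SIMULTANEOUSLY FOR EVERY measurable `S`:
`|π(S) − P(Y_b ∈ S)| ≤ R⁻¹ Σ_{j<R} Σ_{n<m} 1{Z_j(b + n) ∉ Δ} + mε + r^{b+m} p₀ W`. [ours] -/
theorem crnLag_replicas_totalVariation_certificate [MeasurableEq Ω] [Fact (Measurable w)] (hw0 : ∀ y, 0 < w y) {x₀ : Ω}
    (hmax : ∀ y, w y ≤ w x₀) [IsProbabilityMeasure (q.withDensity fun y => ENNReal.ofReal (w y))]
    (Khat : Kernel (Ω × Ω) (Ω × Ω)) [IsMarkovKernel Khat]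
    (hK : ∀ z : Ω × Ω, Khat z = (q.prod (volume : Measure unitInterval)).map (fun p : Ω × unitInterval =>
      ((if (p.2 : ℝ) * w z.1 ≤ w p.1 then p.1 else z.1), (if (p.2 : ℝ) * w z.2 ≤ w p.1 then p.1 else z.2))))
    (ν : Measure (Ω × Ω)) [IsProbabilityMeasure ν] (hlag : ν.map Prod.fst = (ν.map Prod.snd).bind (indepMH q w))
    (hZm : ∀ j, Measurable (Z j))
    (hlaw : ∀ j, μ.map (Z j) = Kernel.trajMeasure (X := fun _ : ℕ => Ω × Ω) ν
      (fun n : ℕ => Khat.comap (fun h : (i : ↥(Finset.Iic n)) → Ω × Ω => h ⟨n, Finset.mem_Iic.2 le_rfl⟩)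
        (measurable_pi_apply _)))
    (hind : iIndepFun Z μ) {ε : ℝ} (hε : 0 ≤ ε) {R : ℕ} (hR : 1 ≤ R) (b m : ℕ) :
    1 - m * Real.exp (-(2 * R * ε ^ 2)) ≤ μ.real {ω | ∀ S : Set Ω, MeasurableSet S →
      |(q.withDensity fun y => ENNReal.ofReal (w y)).real S -
          (Kernel.trajMeasure (X := fun _ : ℕ => Ω × Ω) ν
            (fun n : ℕ => Khat.comap (fun h : (i : ↥(Finset.Iic n)) → Ω × Ω => h ⟨n, Finset.mem_Iic.2 le_rfl⟩)
              (measurable_pi_apply _))).real {z | (z b).2 ∈ S}| ≤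
        (R : ℝ)⁻¹ * ∑ j ∈ range R, ∑ n ∈ range m, (Set.diagonal Ω)ᶜ.indicator (1 : Ω × Ω → ℝ) (Z j ω (b + n)) + m * ε +
          (1 - (w x₀)⁻¹) ^ (b + m) * ν.real (Set.diagonal Ω)ᶜ * w x₀} := by
  have hw : Measurable w := Fact.out
  refine (crnLag_replicas_tsum_offDiagonal_certificate hw hw0 hmax Khat hK ν hZm hlaw hind hε hR b m).trans
    (measureReal_mono fun ω hω S hS => ?_)
  exact (crnLag_measureReal_sub_abs_le_tsum_offDiagonal hw0 hmax Khat hK ν hlag hS b).trans hω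

/-- **THE SAME EVENT CERTIFIES EVERY BOUNDED OBSERVABLE**: with probability `≥ 1 − m·exp(−2Rε²)`, for EVERY measurable `a ≤ f ≤ c` at once,
`|π f − E f(Y_b)| ≤ (c − a)·(R⁻¹ Σ_{j<R} Σ_{n<m} 1{Z_j(b + n) ∉ Δ} + mε + r^{b+m} p₀ W)`. [ours] -/
theorem crnLag_replicas_bias_certificate [MeasurableEq Ω] [Fact (Measurable w)] (hw0 : ∀ y, 0 < w y) {x₀ : Ω}
    (hmax : ∀ y, w y ≤ w x₀) [IsProbabilityMeasure (q.withDensity fun y => ENNReal.ofReal (w y))]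
    (Khat : Kernel (Ω × Ω) (Ω × Ω)) [IsMarkovKernel Khat]
    (hK : ∀ z : Ω × Ω, Khat z = (q.prod (volume : Measure unitInterval)).map (fun p : Ω × unitInterval =>
      ((if (p.2 : ℝ) * w z.1 ≤ w p.1 then p.1 else z.1), (if (p.2 : ℝ) * w z.2 ≤ w p.1 then p.1 else z.2))))
    (ν : Measure (Ω × Ω)) [IsProbabilityMeasure ν] (hlag : ν.map Prod.fst = (ν.map Prod.snd).bind (indepMH q w))
    (hZm : ∀ j, Measurable (Z j))
    (hlaw : ∀ j, μ.map (Z j) = Kernel.trajMeasure (X := fun _ : ℕ => Ω × Ω) ν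
      (fun n : ℕ => Khat.comap (fun h : (i : ↥(Finset.Iic n)) → Ω × Ω => h ⟨n, Finset.mem_Iic.2 le_rfl⟩)
        (measurable_pi_apply _)))
    (hind : iIndepFun Z μ) {ε : ℝ} (hε : 0 ≤ ε) {R : ℕ} (hR : 1 ≤ R) (b m : ℕ) :
    1 - m * Real.exp (-(2 * R * ε ^ 2)) ≤ μ.real {ω | ∀ (f : Ω → ℝ) (a c : ℝ), Measurable f → (∀ x, a ≤ f x) → (∀ x, f x ≤ c) →
      |∫ x, f x ∂(q.withDensity fun y => ENNReal.ofReal (w y)) -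
          ∫ z, f ((z b).2) ∂(Kernel.trajMeasure (X := fun _ : ℕ => Ω × Ω) ν
            (fun n : ℕ => Khat.comap (fun h : (i : ↥(Finset.Iic n)) → Ω × Ω => h ⟨n, Finset.mem_Iic.2 le_rfl⟩)
              (measurable_pi_apply _)))| ≤
        (c - a) * ((R : ℝ)⁻¹ * ∑ j ∈ range R, ∑ n ∈ range m, (Set.diagonal Ω)ᶜ.indicator (1 : Ω × Ω → ℝ) (Z j ω (b + n)) + m * ε +
          (1 - (w x₀)⁻¹) ^ (b + m) * ν.real (Set.diagonal Ω)ᶜ * w x₀)} := by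
  have hw : Measurable w := Fact.out
  refine (crnLag_replicas_tsum_offDiagonal_certificate hw hw0 hmax Khat hK ν hZm hlaw hind hε hR b m).trans
    (measureReal_mono fun ω hω f a c hf ha hc => ?_)
  have hca : 0 ≤ c - a := by
    have := (ha x₀).trans (hc x₀); linarith
  exact (crnLag_bias_abs_le_tsum_offDiagonal hw0 hmax Khat hK ν hlag hf ha hc b).trans (mul_le_mul_of_nonneg_left hω hca)

end Summit.Ventures.LatticeQCDFlow.Exactness

end
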